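import Literature.NumberTheory.Automorphic.GodementJacquetZetaKernelTheta
import Mathlib.Analysis.SpecialFunctions.ImproperIntegrals
import HarnessLib

/-!
# Mellin integrals of the weights `ω_s`, `ω'_w` over the split centre `A_G ≅ ℝ`

Topic `NumberTheory/Automorphic`; namespace `Literature.NumberTheory.Automorphic`. A brick of the
discharge of `GodementJacquet1972_gjZeta_meromorphic`: the elementary integrals over
`A_G = {z(r) : r > 0} ≤ GL_n(𝔸_K)` (`n ≥ 1`) which produce the polar terms of the analytic
continuation for `n = 1` (Tate; Godement–Jacquet (1972), §13, the terms `Φ(0)/s` and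
`Φ̂(0)/(s - n)`), in the logarithmic coordinate `v = centerLog a = log |det a|_𝔸` of `GLnZetaKernel`
(`centerLog_* α = c · dv`):

* `coe_adelicAbsDet_mul_center_mul` — `|det (x a y)|_𝔸 = |det x|_𝔸 e^{v} |det y|_𝔸`;
* `gjTruncF_one_mul_center_mul_eq`, `gjDualF_one_mul_center_mul_eq` — the weights
  `ω_s = |det|^s 𝟙_{|det|<1}` and `ω'_w = |det|^w 𝟙_{|det|>1}` along `A_G` are
  `𝟙_{t+v<0} e^{s(t+v)}` and `𝟙_{t+v>0} e^{w(t+v)}`, `t = log (|det x|_𝔸 |det y|_𝔸)`;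
* `integrable_and_integral_gjTruncF_one_center` — **`∫_{A_G} ω_s(x a y) dα(a) = c / s`** for
  `Re s > 0` (integrable integrand), and `integrable_and_integral_gjDualF_one_center` —
  **`∫_{A_G} ω'_w(x a y) dα(a) = -c / w`** for `Re w < 0`; both independent of `x, y`
  (Mathlib's `integral_exp_mul_complex_Iic` / `_Ioi`).

Everything is proved; no definitions.

## References

* R. Godement, H. Jacquet, *Zeta functions of simple algebras*, LNM 260 (1972), §13
  [GodementJacquet1972].
* J. Tate, in Cassels–Fröhlich (eds.), *Algebraic Number Theory* (1967), Ch. XV, proof of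
  Thm. 4.4.1 [CasselsFrohlichANT1967].
-/

noncomputable section

open MeasureTheory Measure Set Filter Topology IsDedekindDomain NumberField Real
open Literature.MeasureTheory.Group
open scoped ENNReal NNReal ComplexConjugate MatrixGroups

namespace Literature.NumberTheory.Automorphic

section Mellin

variable {n : ℕ} {K : Type} [Field K] [NumberField K]

attribute [local instance] adelicBorel borelSpace_adelic locallyCompactSpace_adelic
  secondCountableTopology_gl_adelic

/-- `|det g|_𝔸` as a real number is `glAbsDet` (definitional bookkeeping between `adelicAbsDet` and
`glAbsDet`). [folklore] -/
theorem coe_adelicAbsDet_eq (g : GL (Fin n) (AdeleRing (𝓞 K) K)) :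
    ((adelicAbsDet n K g : ℝ≥0) : ℝ) = (((glAbsDet n K g : ℝ≥0ˣ) : ℝ≥0) : ℝ) := rfl

/-- **`|det (x a y)|_𝔸 = |det x|_𝔸 e^{v} |det y|_𝔸`** with `v = centerLog a` (`a ∈ A_G`, `n ≥ 1`). [folklore] -/
theorem coe_adelicAbsDet_mul_center_mul (hn : 0 < n) (x y : (AdelicGroupData.gl n K).Adelic)
    (a : (AdelicGroupData.gl n K).center') :
    ((adelicAbsDet n K (x * (a : (AdelicGroupData.gl n K).Adelic) * y) : ℝ≥0) : ℝ) =
      (adelicAbsDet n K x : ℝ) * Real.exp (centerLog n K hn a) * (adelicAbsDet n K y : ℝ) := by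
  rw [exp_centerLog, coe_adelicAbsDet_eq, coe_adelicAbsDet_eq, coe_adelicAbsDet_eq,
    glAbsDet_adelic_mul, glAbsDet_adelic_mul, Units.val_mul, Units.val_mul, NNReal.coe_mul, NNReal.coe_mul]

/-- For `r > 0` real, `(r : ℂ)^s = exp(s log r)`. [folklore] -/
theorem ofReal_cpow_eq_exp {r : ℝ} (hr : 0 < r) (s : ℂ) :
    ((r : ℂ)) ^ s = Complex.exp (s * (Real.log r : ℂ)) := by
  rw [Complex.cpow_def_of_ne_zero (Complex.ofReal_ne_zero.2 hr.ne'), Complex.ofReal_log hr.le, mul_comm]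

/-- **The weight `ω_s` along `A_G` in the logarithmic coordinate**: with
`t = log (|det x|_𝔸 |det y|_𝔸)` and `v = centerLog a`,
`ω_s(x a y) = 𝟙_{t + v < 0} e^{s (t + v)}`. [folklore] -/
theorem gjTruncF_one_mul_center_mul_eq (hn : 0 < n) (s : ℂ) (x y : (AdelicGroupData.gl n K).Adelic)
    (a : (AdelicGroupData.gl n K).center') :
    gjTruncF n K (fun _ => (1 : ℂ)) s (x * (a : (AdelicGroupData.gl n K).Adelic) * y) =
      (Set.Iio (-(Real.log ((adelicAbsDet n K x : ℝ) * (adelicAbsDet n K y : ℝ))))).indicator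
        (fun v : ℝ => Complex.exp (s * ((Real.log ((adelicAbsDet n K x : ℝ) * (adelicAbsDet n K y : ℝ)) + v : ℝ) : ℂ)))
        (centerLog n K hn a) := by
  set R : ℝ := (adelicAbsDet n K x : ℝ) * (adelicAbsDet n K y : ℝ) with hR
  have hRpos : 0 < R := mul_pos (adelicAbsDet_pos _) (adelicAbsDet_pos _)
  have hdet0 : ((adelicAbsDet n K (x * (a : (AdelicGroupData.gl n K).Adelic) * y) : ℝ≥0) : ℝ) =
      R * Real.exp (centerLog n K hn a) := by
    rw [coe_adelicAbsDet_mul_center_mul hn, hR]; ring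
  -- generalize the `Adelic`-typed product to a `GL`-typed variable (so that `rw` is available)
  set g : GL (Fin n) (AdeleRing (𝓞 K) K) := x * (a : (AdelicGroupData.gl n K).Adelic) * y with hg
  have hdet : ((adelicAbsDet n K g : ℝ≥0) : ℝ) = R * Real.exp (centerLog n K hn a) := hdet0
  have hlog : Real.log (R * Real.exp (centerLog n K hn a)) = Real.log R + centerLog n K hn a := by
    rw [Real.log_mul hRpos.ne' (Real.exp_pos _).ne', Real.log_exp]
  have hmem : g ∈ (detAtLeastOne n K)ᶜ ↔ centerLog n K hn a ∈ Set.Iio (-Real.log R) := by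
    rw [Set.mem_compl_iff, mem_detAtLeastOne_iff, not_le, Set.mem_Iio, hdet]
    constructor
    · intro h
      have h1 : Real.log (R * Real.exp (centerLog n K hn a)) < Real.log 1 :=
        Real.log_lt_log (mul_pos hRpos (Real.exp_pos _)) h
      rw [hlog, Real.log_one] at h1
      linarith
    · intro h
      have h1 : Real.log R + centerLog n K hn a < 0 := by linarith
      have h2 := Real.exp_lt_exp.2 h1
      rwa [Real.exp_add, Real.exp_log hRpos, Real.exp_zero] at h2
  rw [gjTruncF_apply]
  by_cases hg' : g ∈ (detAtLeastOne n K)ᶜ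
  · rw [Set.indicator_of_mem hg', Set.indicator_of_mem (hmem.1 hg'), one_mul, hdet,
      ofReal_cpow_eq_exp (mul_pos hRpos (Real.exp_pos _)), hlog]
  · rw [Set.indicator_of_notMem hg', Set.indicator_of_notMem (fun h => hg' (hmem.2 h))]

/-- **The dual weight `ω'_w` along `A_G`**: `ω'_w(x a y) = 𝟙_{t + v > 0} e^{w (t + v)}`. [folklore] -/
theorem gjDualF_one_mul_center_mul_eq (hn : 0 < n) (w : ℂ) (x y : (AdelicGroupData.gl n K).Adelic)
    (a : (AdelicGroupData.gl n K).center') :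
    gjDualF n K (fun _ => (1 : ℂ)) w (x * (a : (AdelicGroupData.gl n K).Adelic) * y) =
      (Set.Ioi (-(Real.log ((adelicAbsDet n K x : ℝ) * (adelicAbsDet n K y : ℝ))))).indicator
        (fun v : ℝ => Complex.exp (w * ((Real.log ((adelicAbsDet n K x : ℝ) * (adelicAbsDet n K y : ℝ)) + v : ℝ) : ℂ)))
        (centerLog n K hn a) := by
  set R : ℝ := (adelicAbsDet n K x : ℝ) * (adelicAbsDet n K y : ℝ) with hR
  have hRpos : 0 < R := mul_pos (adelicAbsDet_pos _) (adelicAbsDet_pos _)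
  have hdet0 : ((adelicAbsDet n K (x * (a : (AdelicGroupData.gl n K).Adelic) * y) : ℝ≥0) : ℝ) =
      R * Real.exp (centerLog n K hn a) := by
    rw [coe_adelicAbsDet_mul_center_mul hn, hR]; ring
  set g : GL (Fin n) (AdeleRing (𝓞 K) K) := x * (a : (AdelicGroupData.gl n K).Adelic) * y with hg
  have hdet : ((adelicAbsDet n K g : ℝ≥0) : ℝ) = R * Real.exp (centerLog n K hn a) := hdet0
  have hlog : Real.log (R * Real.exp (centerLog n K hn a)) = Real.log R + centerLog n K hn a := by
    rw [Real.log_mul hRpos.ne' (Real.exp_pos _).ne', Real.log_exp]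
  have hmem : g ∈ detGtOne n K ↔ centerLog n K hn a ∈ Set.Ioi (-Real.log R) := by
    rw [mem_detGtOne_iff, Set.mem_Ioi, hdet]
    constructor
    · intro h
      have h1 : Real.log 1 < Real.log (R * Real.exp (centerLog n K hn a)) :=
        Real.log_lt_log one_pos h
      rw [hlog, Real.log_one] at h1
      linarith
    · intro h
      have h1 : 0 < Real.log R + centerLog n K hn a := by linarith
      have h2 := Real.exp_lt_exp.2 h1
      rwa [Real.exp_add, Real.exp_log hRpos, Real.exp_zero] at h2
  rw [gjDualF_apply]
  by_cases hg' : g ∈ detGtOne n K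
  · rw [Set.indicator_of_mem hg', Set.indicator_of_mem (hmem.1 hg'), one_mul, hdet,
      ofReal_cpow_eq_exp (mul_pos hRpos (Real.exp_pos _)), hlog]
  · rw [Set.indicator_of_notMem hg', Set.indicator_of_notMem (fun h => hg' (hmem.2 h))]

variable {α : Measure (AdelicGroupData.gl n K).center'} {c : ℝ≥0}

/-- **The Mellin integral of `ω_s` over `A_G`**: for `Re s > 0`, every Haar measure `α` on `A_G`
with `centerLog_* α = c · dv`, and all `x, y ∈ GL_n(𝔸_K)`,
`∫_{A_G} ω_s(x a y) dα(a) = c / s` — independently of `x, y`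
(`= c ∫_{t+v<0} e^{s(t+v)} dv`). The integrand is integrable. This is the source of the pole at
`s = 0` for `n = 1` (Tate). [cite: GodementJacquet1972, §13] -/
theorem integrable_and_integral_gjTruncF_one_center (hn : 0 < n)
    (hα : α.map (centerLog n K hn) = c • (volume : Measure ℝ)) {s : ℂ} (hs : 0 < s.re)
    (x y : (AdelicGroupData.gl n K).Adelic) :
    Integrable (fun a : (AdelicGroupData.gl n K).center' =>
        gjTruncF n K (fun _ => (1 : ℂ)) s (x * (a : (AdelicGroupData.gl n K).Adelic) * y)) α ∧
      ∫ a : (AdelicGroupData.gl n K).center',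
          gjTruncF n K (fun _ => (1 : ℂ)) s (x * (a : (AdelicGroupData.gl n K).Adelic) * y) ∂α = (c : ℂ) / s := by
  set t : ℝ := Real.log ((adelicAbsDet n K x : ℝ) * (adelicAbsDet n K y : ℝ)) with ht
  set f : ℝ → ℂ := (Set.Iio (-t)).indicator (fun v : ℝ => Complex.exp (s * ((t + v : ℝ) : ℂ))) with hf
  have heq : (fun a : (AdelicGroupData.gl n K).center' =>
      gjTruncF n K (fun _ => (1 : ℂ)) s (x * (a : (AdelicGroupData.gl n K).Adelic) * y)) =
      fun a => f (centerLog n K hn a) := by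
    funext a; exact gjTruncF_one_mul_center_mul_eq hn s x y a
  -- the model integral on `ℝ`
  have hexp : ∀ v : ℝ, Complex.exp (s * ((t + v : ℝ) : ℂ)) = Complex.exp (s * t) * Complex.exp (s * v) := by
    intro v; rw [Complex.ofReal_add, mul_add, Complex.exp_add]
  have hfi : Integrable f := by
    rw [hf, integrable_indicator_iff measurableSet_Iio]
    have h1 := (integrableOn_exp_mul_complex_Iic hs (-t)).mono_set (Set.Iio_subset_Iic_self)
    refine (h1.const_mul (Complex.exp (s * t))).congr (Eventually.of_forall fun v => ?_)
    simp only [hexp]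
  have hfint : ∫ v, f v = 1 / s := by
    rw [hf, integral_indicator measurableSet_Iio, ← integral_Iic_eq_integral_Iio]
    simp_rw [hexp]
    rw [integral_const_mul, integral_exp_mul_complex_Iic hs, ← mul_div_assoc, ← Complex.exp_add]
    have : s * ↑t + s * ↑(-t) = 0 := by push_cast; ring
    rw [this, Complex.exp_zero]
  -- transport along `centerLog`
  have hmp : MeasurePreserving (centerLog n K hn) α (c • (volume : Measure ℝ)) :=
    ⟨(centerLog n K hn).continuous.measurable, hα⟩
  refine ⟨?_, ?_⟩
  · rw [heq]
    exact (hmp.integrable_comp_emb (centerLog n K hn).measurableEmbedding).2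
      (hfi.smul_measure ENNReal.coe_ne_top)
  · rw [heq, integral_comp_centerLog_eq_smul hn hα f, hfint, Complex.real_smul]
    ring

/-- **The Mellin integral of `ω'_w` over `A_G`**: for `Re w < 0`,
`∫_{A_G} ω'_w(x a y) dα(a) = -c / w`, independently of `x, y` (`= c ∫_{t+v>0} e^{w(t+v)} dv`); the
integrand is integrable. With `w = n - s` this is `c / (s - n)`: the source of the pole at `s = 1`
for `n = 1` (Tate). [cite: GodementJacquet1972, §13] -/
theorem integrable_and_integral_gjDualF_one_center (hn : 0 < n)
    (hα : α.map (centerLog n K hn) = c • (volume : Measure ℝ)) {w : ℂ} (hw : w.re < 0)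
    (x y : (AdelicGroupData.gl n K).Adelic) :
    Integrable (fun a : (AdelicGroupData.gl n K).center' =>
        gjDualF n K (fun _ => (1 : ℂ)) w (x * (a : (AdelicGroupData.gl n K).Adelic) * y)) α ∧
      ∫ a : (AdelicGroupData.gl n K).center',
          gjDualF n K (fun _ => (1 : ℂ)) w (x * (a : (AdelicGroupData.gl n K).Adelic) * y) ∂α = -(c : ℂ) / w := by
  set t : ℝ := Real.log ((adelicAbsDet n K x : ℝ) * (adelicAbsDet n K y : ℝ)) with ht
  set f : ℝ → ℂ := (Set.Ioi (-t)).indicator (fun v : ℝ => Complex.exp (w * ((t + v : ℝ) : ℂ))) with hf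
  have heq : (fun a : (AdelicGroupData.gl n K).center' =>
      gjDualF n K (fun _ => (1 : ℂ)) w (x * (a : (AdelicGroupData.gl n K).Adelic) * y)) =
      fun a => f (centerLog n K hn a) := by
    funext a; exact gjDualF_one_mul_center_mul_eq hn w x y a
  have hexp : ∀ v : ℝ, Complex.exp (w * ((t + v : ℝ) : ℂ)) = Complex.exp (w * t) * Complex.exp (w * v) := by
    intro v; rw [Complex.ofReal_add, mul_add, Complex.exp_add]
  have hfi : Integrable f := by
    rw [hf, integrable_indicator_iff measurableSet_Ioi]
    have h1 := integrableOn_exp_mul_complex_Ioi hw (-t)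
    refine (h1.const_mul (Complex.exp (w * t))).congr (Eventually.of_forall fun v => ?_)
    simp only [hexp]
  have hfint : ∫ v, f v = -1 / w := by
    rw [hf, integral_indicator measurableSet_Ioi]
    simp_rw [hexp]
    rw [integral_const_mul, integral_exp_mul_complex_Ioi hw, mul_div_assoc', mul_neg, ← Complex.exp_add]
    have : w * ↑t + w * ↑(-t) = 0 := by push_cast; ring
    rw [this, Complex.exp_zero]
  have hmp : MeasurePreserving (centerLog n K hn) α (c • (volume : Measure ℝ)) :=
    ⟨(centerLog n K hn).continuous.measurable, hα⟩
  refine ⟨?_, ?_⟩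
  · rw [heq]
    exact (hmp.integrable_comp_emb (centerLog n K hn).measurableEmbedding).2
      (hfi.smul_measure ENNReal.coe_ne_top)
  · rw [heq, integral_comp_centerLog_eq_smul hn hα f, hfint, Complex.real_smul]
    ring

end Mellin

end Literature.NumberTheory.Automorphic
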